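import Summits.HodgeConjecture.HodgeConjecture.Theorems.F0P3cStCharTSTubeOrbitSurj        -- ★ p851835 (LH6-p03 g5) (J5c) `exists_conj_eq_of_schedule` (⊇); brings ★ (J5b)(J5a₀) `…TubeNewtonStep`, ★ p851809 (J4c) `…TubeSubsetSandwich.inv_mul_conj_mem_sandwich` (⊆), ★ `isCompact_isOpen_comap_congruenceGL`
import Summits.HodgeConjecture.HodgeConjecture.Theorems.F0P3cStCharTSAbelianSandwich      -- ★ p851707 (F0P2-p06 g17) (J4a) `coe_sandwich_eq`, `mem_sandwich_iff`, `le_sandwich_and_sandwich_le`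
import HarnessLib

/-!
# F0 · P3c · line LH6 «StCharTS» — ROAD «JAC-LOC» brick «ORBIT-TUBE★ (SET IDENTITY)»: for a REGULAR split-torus element `s` of `U(Φ₃)(K)` over a
# non-archimedean local field, `Ad(K_γ)(s·T_γ) = s·P̃` with the ABELIAN SANDWICH `P̃ = B̄ ⊔ (T_γ ⊔ (B ⊔ K_ε))` (Harish-Chandra 1970 Lemma 22)

Cell `pub/hodgecm-mathlib`, crux H413 = `stmt-HodgeConjecture-24833` (lane `--supports … --as helper`), route HCCMUnconditional; seat LH1-p03 (g9), brick dealt BY NAME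
by the holder of the road «JAC-LOC» LH6-p03 (g5) (bus F0∕P3b 2026-09-02T15:19:58Z item (2), re-dealt 15:24:20Z).  THEOREMS ONLY, sorry-free, no definition ∕
instance ∕ notation ∕ named fact; consumers (J6) LH6-p04 and (J6-T) LH3-p02.

SETTING = ★ (J5c)'s: `K` a non-archimedean LOCAL field with its valuative relation (`v := valuation K`), `σ` a continuous isometric involution, `2 ∈ Kˣ`, `J = Φ₃`,
`U = ↥(unitaryGroupOfForm σ J)`, `T = torusU σ J`, levels `K_δ := (congruenceGL 3 δ).comap U.subtype` (compact open, ★ `isCompact_isOpen_comap_congruenceGL`).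
For a REGULAR `s = diag(d) ∈ T` and levels `γ ≤ γ′`, `γγ′ ≤ ε`, subgroups `B ≤ K_γ′`, `Bbar ≤ K_γ′` whose carriers ARE the van Dijk image boxes (the two inclusions are
the binders `hB`∕`hBbar` of ★ (J4c) and `hBsub`∕`hBbarsub` of ★ (J5c)), and `K_ε ≤ K_γ′` with `K_γ′ ∕ K_ε` abelian (the binders `hEK`, `hab` of ★ (J4a) `coe_sandwich_eq`,
discharged on the road by (J4b), not here), write `P̃ := Bbar ⊔ ((K_γ ⊓ T) ⊔ (B ⊔ K_ε))` — a genuine `Subgroup U` with carrier `B̄ · T_γ · B · K_ε` (★ `coe_sandwich_eq`).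

* §1 `image_conj_prod_eq_setOf` — pure group algebra (any group): `(p ↦ p.1 p.2 p.1⁻¹) '' (A ×ˢ s·(A ⊓ C)) = {x | ∃ k ∈ ↑A, ∃ τ ∈ ↑A, τ ∈ C ∧ k s τ k⁻¹ = x}`.
* §2 **`setOf_conj_eq_smul_sandwich`** (head (a)): `{x | ∃ k ∈ ↑K_γ, ∃ τ ∈ ↑K_γ, τ ∈ T ∧ k s τ k⁻¹ = x} = s • ↑P̃` — `⊆` is ★ (J4c) `inv_mul_conj_mem_sandwich`,
  `⊇` is ★ (J4a) `mem_sandwich_iff` (every `p ∈ P̃` is `b̄ c b e`) followed by ★ (J5c) `exists_conj_eq_of_schedule`.  Binders = the UNION of the binder lists of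
  ★ (J4c) and ★ (J5c) (verbatim names) + `hEK hab` and `hBbarK : Bbar ≤ K_γ′` of ★ (J4a) (its `hB` is (J4c)'s `hBK`; its `hC : K_γ ⊓ T ≤ K_γ′` is derived from `γ ≤ γ′`).
* §2 **`image_conj_prod_eq_smul_sandwich`** (head (b)): the product-set form `(p ↦ p.1 p.2 p.1⁻¹) '' (↑K_γ ×ˢ (s • ↑(K_γ ⊓ T))) = s • ↑P̃` (§1 + (a)).
* §3 (head (c)) `sandwich_le_and_le`, `isOpen_sandwich`, `isOpen_smul_sandwich`, `isClosed_smul_sandwich`, `isCompact_smul_sandwich`, `measurableSet_smul_sandwich`: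
  `K_ε ≤ P̃ ≤ K_γ′`, so `P̃` and `s • ↑P̃` are open (an open subgroup sits below `P̃`), closed, compact (inside the compact `s • K_γ′`) and Borel-measurable.

HONEST LABEL: count-neutral algebra∕topology for the road «JAC-LOC» (hyperbolic half of the print residue «WIF» of the (S-𝔇) organ `stub_EllipticPackage`); closes no
organ.  HC_CM is proved only modulo the 7 printed citations (2 remaining: hLiu418 = `stmt-HodgeConjecture-24832`, h413 = `stmt-HodgeConjecture-24833`) until rung 0 closes.

## References
* [HarishChandra1970] Harish-Chandra, *Harmonic analysis on reductive p-adic groups*, LNM 162 (1970), Lemma 22.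
* [vanDijk1972] G. van Dijk, *Computation of certain induced characters of p-adic groups*, Math. Ann. 199 (1972) 229–240, §2.
* [Casselman1995] W. Casselman, *Introduction to the theory of admissible representations of p-adic reductive groups* (1995), Prop. 1.4.4.
* [Rogawski1990] J. D. Rogawski, *Automorphic Representations of Unitary Groups in Three Variables*, Ann. of Math. Stud. 123 (1990), §12.5 p. 182.
* [BourbakiGT1] N. Bourbaki, *General Topology* I, Ch. III §2 n° 1 (open subgroups are closed), Ch. I §9 n° 3–4 (compact sets in Hausdorff spaces).
-/

set_option autoImplicit false
-- the mandated namespace has the single-problem summit's repeated segment (`HodgeConjecture.HodgeConjecture`)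
set_option linter.dupNamespace false

open Matrix ValuativeRel Filter Topology Set
open Literature.NumberTheory.Automorphic Literature.NumberTheory.Automorphic.UnitaryGroup Literature.NumberTheory.Automorphic.UnitaryGroup.HeisRing
open Literature.NumberTheory.Rogawski1990 Literature.Topology.Algebra
open Summit.HodgeConjecture.HodgeConjecture.Cruxes.H413.F0P3cStCharTSTubeSubsetSandwich
open Summit.HodgeConjecture.HodgeConjecture.Cruxes.H413.F0P3cStCharTSTubeOrbitSurj
open Summit.HodgeConjecture.HodgeConjecture.Cruxes.H413.F0P3cStCharTSAbelianSandwich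
open scoped MatrixGroups Pointwise

namespace Summit.HodgeConjecture.HodgeConjecture.Cruxes.H413.F0P3cStCharTSTubeOrbitEq

/-! ## §1 Pure group algebra: the image form of the saturated tube -/

section Algebra

variable {G : Type*} [Group G]

/-- **The `A`-saturation of the coset `s·(A ⊓ C)` as an image**: `(p ↦ p.1 · p.2 · p.1⁻¹) '' (A ×ˢ s·(A ⊓ C)) = {x | ∃ k ∈ ↑A, ∃ τ ∈ ↑A, τ ∈ C ∧ k s τ k⁻¹ = x}`
(on the road: `A = K_γ`, `C = T`; memberships `k, τ ∈ ↑A` in the COERCED set, the shape of ★ (J6-T) `setOf_conj_eq_smul_of_map`'s hypothesis). [cite: HarishChandra1970, Lemma 22] -/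
theorem image_conj_prod_eq_setOf (A C : Subgroup G) (s : G) :
    (fun p : G × G => p.1 * p.2 * p.1⁻¹) '' ((A : Set G) ×ˢ (s • ((A ⊓ C : Subgroup G) : Set G))) =
      {x | ∃ k ∈ (A : Set G), ∃ τ ∈ (A : Set G), τ ∈ C ∧ k * s * τ * k⁻¹ = x} := by
  ext x
  simp only [Set.mem_image, Set.mem_prod, Set.mem_setOf_eq, Prod.exists]
  constructor
  · rintro ⟨k, y, ⟨hk, hy⟩, rfl⟩
    obtain ⟨τ, hτ, rfl⟩ := Set.mem_smul_set.1 hy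
    exact ⟨k, hk, τ, (Subgroup.mem_inf.1 hτ).1, (Subgroup.mem_inf.1 hτ).2, by rw [smul_eq_mul, mul_assoc k s τ]⟩
  · rintro ⟨k, hk, τ, hτA, hτC, rfl⟩
    exact ⟨k, s * τ, ⟨hk, Set.mem_smul_set.2 ⟨τ, Subgroup.mem_inf.2 ⟨hτA, hτC⟩, smul_eq_mul _ _⟩⟩, by rw [mul_assoc k s τ]⟩

end Algebra

/-! ## §2 The set identity `Ad(K_γ)(s·T_γ) = s·P̃` -/

variable {K : Type*} [Field K] [ValuativeRel K] [TopologicalSpace K] [IsNonarchimedeanLocalField K]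
  (σ : K →+* K) (hσ : ∀ x, σ (σ x) = x) [Invertible (2 : K)]
  {J : Matrix (Fin 3) (Fin 3) K} (hJ : J = (StdForm.antidiagonal 3).over K)

include hσ in
/-- **(a) ORBIT-TUBE★ — THE SET IDENTITY `Ad(K_γ)(s·T_γ) = s·P̃`.**  Under the union of the hypotheses of ★ (J4c) `inv_mul_conj_mem_sandwich` (levels `γ < 1`,
`γ ≤ γ′`, `γγ′ ≤ ε`, `v(½)γ ≤ 1`, the depth conditions at radius `γ`, `B ≤ K_γ′`, the image boxes INSIDE `B`, `Bbar`) and of ★ (J5c) `exists_conj_eq_of_schedule`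
(`σ` continuous, `γ ≠ 0`, a level schedule `δ μ ρx ρy ρx′ ρy′` with `K_{δ n} → 1`, (L1) reverse, `B`, `Bbar` INSIDE the image boxes), plus `K_ε ≤ K_γ′`, `K_γ′ ∕ K_ε`
abelian and `Bbar ≤ K_γ′` (★ (J4a)): **`{x | ∃ k ∈ ↑K_γ, ∃ τ ∈ ↑K_γ, τ ∈ T ∧ k s τ k⁻¹ = x} = s • ↑(Bbar ⊔ ((K_γ ⊓ T) ⊔ (B ⊔ K_ε)))`** (memberships in the coerced set `↑K_γ`,
the shape the CM pull-back ★ (J6-T) `cm_setOf_conj_eq_smul` consumes as `hOrb′`).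
`⊆`: ★ (J4c).  `⊇`: a point of `P̃` is `b̄ c b e` (★ `mem_sandwich_iff`), and ★ (J5c) conjugates `s τ` onto `s b̄ c b e`.
[cite: HarishChandra1970, Lemma 22] [cite: vanDijk1972, §2] [cite: Casselman1995, Prop. 1.4.4] [cite: Rogawski1990, §12.5 p. 182] -/
theorem setOf_conj_eq_smul_sandwich (hσc : Continuous σ) (hv : ∀ x, valuation K (σ x) = valuation K x)
    (s : ↥(torusU σ J)) (hreg : IsRegularElt ((s : ↥(unitaryGroupOfForm σ J)) : GL (Fin 3) K))
    {d : Fin 3 → Kˣ} (hd : glDiagonal 3 K d = ((s : ↥(unitaryGroupOfForm σ J)) : GL (Fin 3) K))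
    {γ γ' ε : ValueGroupWithZero K} (hγ0 : γ ≠ 0) (hγ1 : γ < 1) (hγγ' : γ ≤ γ') (hε : γ * γ' ≤ ε) (h2γ : valuation K (⅟(2 : K)) * γ ≤ 1)
    (hρ : valuation K (⅟(2 : K)) * valuation K ((((d 0)⁻¹ * d 1 : Kˣ) : K) - σ (((d 0)⁻¹ * d 1 : Kˣ) : K)) * (γ * γ) ≤
      valuation K ((((d 0)⁻¹ * d 2 : Kˣ) : K) - 1) * γ)
    (hρw : valuation K (⅟(2 : K)) * valuation K ((((d 2)⁻¹ * d 1 : Kˣ) : K) - σ (((d 2)⁻¹ * d 1 : Kˣ) : K)) * (γ * γ) ≤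
      valuation K ((((d 2)⁻¹ * d 0 : Kˣ) : K) - 1) * γ)
    -- the level schedule (★ (J5c), verbatim)
    (δ μ ρx ρy ρx' ρy' : ℕ → ValueGroupWithZero K) (hδ0 : δ 0 = ε) (hδsucc : ∀ n, δ (n + 1) = μ n * γ)
    (hδ1 : ∀ n, δ n < 1) (h2δ : ∀ n, valuation K (⅟(2 : K)) * δ n ≤ 1) (hδγ : ∀ n, δ n ≤ γ) (hμγ : ∀ n, μ n ≤ γ)
    (hρxμ : ∀ n, ρx n ≤ μ n) (hρyμ : ∀ n, ρy n ≤ μ n) (hρx'μ : ∀ n, ρx' n ≤ μ n) (hρy'μ : ∀ n, ρy' n ≤ μ n)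
    (hρxδ : ∀ n, valuation K ((((d 0)⁻¹ * d 1 : Kˣ) : K) - 1) * ρx n = δ n) (hρyδ : ∀ n, valuation K ((((d 0)⁻¹ * d 2 : Kˣ) : K) - 1) * ρy n = δ n)
    (hρx'δ : ∀ n, valuation K ((((d 2)⁻¹ * d 1 : Kˣ) : K) - 1) * ρx' n = δ n) (hρy'δ : ∀ n, valuation K ((((d 2)⁻¹ * d 0 : Kˣ) : K) - 1) * ρy' n = δ n)
    (hρn : ∀ n, valuation K (⅟(2 : K)) * valuation K ((((d 0)⁻¹ * d 1 : Kˣ) : K) - σ (((d 0)⁻¹ * d 1 : Kˣ) : K)) * (ρx n * ρx n) ≤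
      valuation K ((((d 0)⁻¹ * d 2 : Kˣ) : K) - 1) * ρy n)
    (hρwn : ∀ n, valuation K (⅟(2 : K)) * valuation K ((((d 2)⁻¹ * d 1 : Kˣ) : K) - σ (((d 2)⁻¹ * d 1 : Kˣ) : K)) * (ρx' n * ρx' n) ≤
      valuation K ((((d 2)⁻¹ * d 0 : Kˣ) : K) - 1) * ρy' n)
    (hδμ : ∀ n, δ n ≤ μ n) (h2μ : ∀ n, valuation K (⅟(2 : K)) * μ n ≤ 1)
    (hbasis : ∀ W ∈ 𝓝 (1 : ↥(unitaryGroupOfForm σ J)), ∃ n, (((congruenceGL 3 (δ n)).comap (unitaryGroupOfForm σ J).subtype :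
      Subgroup ↥(unitaryGroupOfForm σ J)) : Set ↥(unitaryGroupOfForm σ J)) ⊆ W)
    -- (L1) reverse (★ (J5c), verbatim)
    (hL1rev : ∀ (η : ValueGroupWithZero K) (n : ↥(unipotentU σ J)), valuation K (⅟(2 : K)) * η ≤ 1 →
      valuation K (heisX σ n) ≤ η → valuation K (heisY σ hσ hJ n : K) ≤ η →
        (n : ↥(unitaryGroupOfForm σ J)) ∈ (congruenceGL 3 η).comap (unitaryGroupOfForm σ J).subtype)
    -- the subgroups `B`, `Bbar`: EQUAL to the image boxes (★ (J4c)'s `hB`∕`hBbar` and ★ (J5c)'s `hBsub`∕`hBbarsub`), `B ≤ K_γ′`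
    (B Bbar : Subgroup ↥(unitaryGroupOfForm σ J))
    (hBK : B ≤ (congruenceGL 3 γ').comap (unitaryGroupOfForm σ J).subtype)
    (hB : ∀ n : ↥(unipotentU σ J), valuation K (heisX σ n) ≤ valuation K ((((d 0)⁻¹ * d 1 : Kˣ) : K) - 1) * γ →
      valuation K (heisY σ hσ hJ n : K) ≤ valuation K ((((d 0)⁻¹ * d 2 : Kˣ) : K) - 1) * γ → (n : ↥(unitaryGroupOfForm σ J)) ∈ B)
    (hBbar : ∀ n : ↥(unipotentU σ J), valuation K (heisX σ n) ≤ valuation K ((((d 2)⁻¹ * d 1 : Kˣ) : K) - 1) * γ →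
      valuation K (heisY σ hσ hJ n : K) ≤ valuation K ((((d 2)⁻¹ * d 0 : Kˣ) : K) - 1) * γ →
        weylLongU σ hJ * (n : ↥(unitaryGroupOfForm σ J)) * (weylLongU σ hJ)⁻¹ ∈ Bbar)
    (hBsub : ∀ g ∈ B, ∃ n : ↥(unipotentU σ J), (n : ↥(unitaryGroupOfForm σ J)) = g ∧
      valuation K (heisX σ n) ≤ valuation K ((((d 0)⁻¹ * d 1 : Kˣ) : K) - 1) * γ ∧
        valuation K (heisY σ hσ hJ n : K) ≤ valuation K ((((d 0)⁻¹ * d 2 : Kˣ) : K) - 1) * γ)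
    (hBbarsub : ∀ g ∈ Bbar, ∃ m : ↥(unipotentU σ J), weylLongU σ hJ * (m : ↥(unitaryGroupOfForm σ J)) * (weylLongU σ hJ)⁻¹ = g ∧
      valuation K (heisX σ m) ≤ valuation K ((((d 2)⁻¹ * d 1 : Kˣ) : K) - 1) * γ ∧
        valuation K (heisY σ hσ hJ m : K) ≤ valuation K ((((d 2)⁻¹ * d 0 : Kˣ) : K) - 1) * γ)
    -- the abelian-sandwich frame (★ (J4a) `coe_sandwich_eq` with `K := K_γ′`, `E := K_ε`; its `hB` is `hBK`, its `hC` is derived)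
    (hEK : (congruenceGL 3 ε).comap (unitaryGroupOfForm σ J).subtype ≤ (congruenceGL 3 γ').comap (unitaryGroupOfForm σ J).subtype)
    (hab : ∀ x ∈ (congruenceGL 3 γ').comap (unitaryGroupOfForm σ J).subtype, ∀ y ∈ (congruenceGL 3 γ').comap (unitaryGroupOfForm σ J).subtype,
      x * y * x⁻¹ * y⁻¹ ∈ (congruenceGL 3 ε).comap (unitaryGroupOfForm σ J).subtype)
    (hBbarK : Bbar ≤ (congruenceGL 3 γ').comap (unitaryGroupOfForm σ J).subtype) :
    {x : ↥(unitaryGroupOfForm σ J) |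
        ∃ k ∈ (((congruenceGL 3 γ).comap (unitaryGroupOfForm σ J).subtype : Subgroup ↥(unitaryGroupOfForm σ J)) : Set ↥(unitaryGroupOfForm σ J)),
        ∃ τ ∈ (((congruenceGL 3 γ).comap (unitaryGroupOfForm σ J).subtype : Subgroup ↥(unitaryGroupOfForm σ J)) : Set ↥(unitaryGroupOfForm σ J)),
          τ ∈ torusU σ J ∧ k * s * τ * k⁻¹ = x} =
      (s : ↥(unitaryGroupOfForm σ J)) •
        ((Bbar ⊔ ((((congruenceGL 3 γ).comap (unitaryGroupOfForm σ J).subtype) ⊓ torusU σ J) ⊔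
          (B ⊔ (congruenceGL 3 ε).comap (unitaryGroupOfForm σ J).subtype)) : Subgroup ↥(unitaryGroupOfForm σ J)) : Set ↥(unitaryGroupOfForm σ J)) := by
  have hCK : ((congruenceGL 3 γ).comap (unitaryGroupOfForm σ J).subtype) ⊓ torusU σ J ≤ (congruenceGL 3 γ').comap (unitaryGroupOfForm σ J).subtype :=
    inf_le_left.trans (Subgroup.comap_mono (congruenceGL_mono hγγ'))
  ext x
  constructor
  · rintro ⟨k, hk, τ, hτK, hτT, rfl⟩
    refine Set.mem_smul_set.2 ⟨(s : ↥(unitaryGroupOfForm σ J))⁻¹ * (k * s * τ * k⁻¹),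
      inv_mul_conj_mem_sandwich σ hσ hJ hv s hreg hd hγ1 hγγ' hε h2γ hρ hρw B Bbar hBK hB hBbar hk hτK hτT, ?_⟩
    rw [smul_eq_mul, mul_inv_cancel_left]
  · intro hx
    obtain ⟨p, hp, rfl⟩ := Set.mem_smul_set.1 hx
    obtain ⟨bb, hbb, c, hc, b, hb, e, he, rfl⟩ := (mem_sandwich_iff hEK hab hBbarK hCK hBK p).1 hp
    obtain ⟨k, hk, τ, hτK, hτT, hkτ⟩ := exists_conj_eq_of_schedule σ hσ hJ hσc hv s hreg hd hγ0 hγ1 hγγ' hε h2γ hρ hρw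
      δ μ ρx ρy ρx' ρy' hδ0 hδsucc hδ1 h2δ hδγ hμγ hρxμ hρyμ hρx'μ hρy'μ hρxδ hρyδ hρx'δ hρy'δ hρn hρwn hδμ h2μ hbasis hL1rev
      B Bbar hBK hBsub hBbarsub hbb (Subgroup.mem_inf.1 hc).1 (Subgroup.mem_inf.1 hc).2 hb he
    exact ⟨k, hk, τ, hτK, hτT, by rw [hkτ, smul_eq_mul]⟩

include hσ in
/-- **(b) ORBIT-TUBE★, PRODUCT-SET FORM**: `(p ↦ p.1 · p.2 · p.1⁻¹) '' (↑K_γ ×ˢ (s • ↑(K_γ ⊓ T))) = s • ↑(Bbar ⊔ ((K_γ ⊓ T) ⊔ (B ⊔ K_ε)))` — §1 + (a), same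
binders. [cite: HarishChandra1970, Lemma 22] [cite: vanDijk1972, §2] [cite: Rogawski1990, §12.5 p. 182] -/
theorem image_conj_prod_eq_smul_sandwich (hσc : Continuous σ) (hv : ∀ x, valuation K (σ x) = valuation K x)
    (s : ↥(torusU σ J)) (hreg : IsRegularElt ((s : ↥(unitaryGroupOfForm σ J)) : GL (Fin 3) K))
    {d : Fin 3 → Kˣ} (hd : glDiagonal 3 K d = ((s : ↥(unitaryGroupOfForm σ J)) : GL (Fin 3) K))
    {γ γ' ε : ValueGroupWithZero K} (hγ0 : γ ≠ 0) (hγ1 : γ < 1) (hγγ' : γ ≤ γ') (hε : γ * γ' ≤ ε) (h2γ : valuation K (⅟(2 : K)) * γ ≤ 1)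
    (hρ : valuation K (⅟(2 : K)) * valuation K ((((d 0)⁻¹ * d 1 : Kˣ) : K) - σ (((d 0)⁻¹ * d 1 : Kˣ) : K)) * (γ * γ) ≤
      valuation K ((((d 0)⁻¹ * d 2 : Kˣ) : K) - 1) * γ)
    (hρw : valuation K (⅟(2 : K)) * valuation K ((((d 2)⁻¹ * d 1 : Kˣ) : K) - σ (((d 2)⁻¹ * d 1 : Kˣ) : K)) * (γ * γ) ≤
      valuation K ((((d 2)⁻¹ * d 0 : Kˣ) : K) - 1) * γ)
    (δ μ ρx ρy ρx' ρy' : ℕ → ValueGroupWithZero K) (hδ0 : δ 0 = ε) (hδsucc : ∀ n, δ (n + 1) = μ n * γ)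
    (hδ1 : ∀ n, δ n < 1) (h2δ : ∀ n, valuation K (⅟(2 : K)) * δ n ≤ 1) (hδγ : ∀ n, δ n ≤ γ) (hμγ : ∀ n, μ n ≤ γ)
    (hρxμ : ∀ n, ρx n ≤ μ n) (hρyμ : ∀ n, ρy n ≤ μ n) (hρx'μ : ∀ n, ρx' n ≤ μ n) (hρy'μ : ∀ n, ρy' n ≤ μ n)
    (hρxδ : ∀ n, valuation K ((((d 0)⁻¹ * d 1 : Kˣ) : K) - 1) * ρx n = δ n) (hρyδ : ∀ n, valuation K ((((d 0)⁻¹ * d 2 : Kˣ) : K) - 1) * ρy n = δ n)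
    (hρx'δ : ∀ n, valuation K ((((d 2)⁻¹ * d 1 : Kˣ) : K) - 1) * ρx' n = δ n) (hρy'δ : ∀ n, valuation K ((((d 2)⁻¹ * d 0 : Kˣ) : K) - 1) * ρy' n = δ n)
    (hρn : ∀ n, valuation K (⅟(2 : K)) * valuation K ((((d 0)⁻¹ * d 1 : Kˣ) : K) - σ (((d 0)⁻¹ * d 1 : Kˣ) : K)) * (ρx n * ρx n) ≤
      valuation K ((((d 0)⁻¹ * d 2 : Kˣ) : K) - 1) * ρy n)
    (hρwn : ∀ n, valuation K (⅟(2 : K)) * valuation K ((((d 2)⁻¹ * d 1 : Kˣ) : K) - σ (((d 2)⁻¹ * d 1 : Kˣ) : K)) * (ρx' n * ρx' n) ≤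
      valuation K ((((d 2)⁻¹ * d 0 : Kˣ) : K) - 1) * ρy' n)
    (hδμ : ∀ n, δ n ≤ μ n) (h2μ : ∀ n, valuation K (⅟(2 : K)) * μ n ≤ 1)
    (hbasis : ∀ W ∈ 𝓝 (1 : ↥(unitaryGroupOfForm σ J)), ∃ n, (((congruenceGL 3 (δ n)).comap (unitaryGroupOfForm σ J).subtype :
      Subgroup ↥(unitaryGroupOfForm σ J)) : Set ↥(unitaryGroupOfForm σ J)) ⊆ W)
    (hL1rev : ∀ (η : ValueGroupWithZero K) (n : ↥(unipotentU σ J)), valuation K (⅟(2 : K)) * η ≤ 1 →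
      valuation K (heisX σ n) ≤ η → valuation K (heisY σ hσ hJ n : K) ≤ η →
        (n : ↥(unitaryGroupOfForm σ J)) ∈ (congruenceGL 3 η).comap (unitaryGroupOfForm σ J).subtype)
    (B Bbar : Subgroup ↥(unitaryGroupOfForm σ J))
    (hBK : B ≤ (congruenceGL 3 γ').comap (unitaryGroupOfForm σ J).subtype)
    (hB : ∀ n : ↥(unipotentU σ J), valuation K (heisX σ n) ≤ valuation K ((((d 0)⁻¹ * d 1 : Kˣ) : K) - 1) * γ →
      valuation K (heisY σ hσ hJ n : K) ≤ valuation K ((((d 0)⁻¹ * d 2 : Kˣ) : K) - 1) * γ → (n : ↥(unitaryGroupOfForm σ J)) ∈ B)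
    (hBbar : ∀ n : ↥(unipotentU σ J), valuation K (heisX σ n) ≤ valuation K ((((d 2)⁻¹ * d 1 : Kˣ) : K) - 1) * γ →
      valuation K (heisY σ hσ hJ n : K) ≤ valuation K ((((d 2)⁻¹ * d 0 : Kˣ) : K) - 1) * γ →
        weylLongU σ hJ * (n : ↥(unitaryGroupOfForm σ J)) * (weylLongU σ hJ)⁻¹ ∈ Bbar)
    (hBsub : ∀ g ∈ B, ∃ n : ↥(unipotentU σ J), (n : ↥(unitaryGroupOfForm σ J)) = g ∧
      valuation K (heisX σ n) ≤ valuation K ((((d 0)⁻¹ * d 1 : Kˣ) : K) - 1) * γ ∧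
        valuation K (heisY σ hσ hJ n : K) ≤ valuation K ((((d 0)⁻¹ * d 2 : Kˣ) : K) - 1) * γ)
    (hBbarsub : ∀ g ∈ Bbar, ∃ m : ↥(unipotentU σ J), weylLongU σ hJ * (m : ↥(unitaryGroupOfForm σ J)) * (weylLongU σ hJ)⁻¹ = g ∧
      valuation K (heisX σ m) ≤ valuation K ((((d 2)⁻¹ * d 1 : Kˣ) : K) - 1) * γ ∧
        valuation K (heisY σ hσ hJ m : K) ≤ valuation K ((((d 2)⁻¹ * d 0 : Kˣ) : K) - 1) * γ)
    (hEK : (congruenceGL 3 ε).comap (unitaryGroupOfForm σ J).subtype ≤ (congruenceGL 3 γ').comap (unitaryGroupOfForm σ J).subtype)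
    (hab : ∀ x ∈ (congruenceGL 3 γ').comap (unitaryGroupOfForm σ J).subtype, ∀ y ∈ (congruenceGL 3 γ').comap (unitaryGroupOfForm σ J).subtype,
      x * y * x⁻¹ * y⁻¹ ∈ (congruenceGL 3 ε).comap (unitaryGroupOfForm σ J).subtype)
    (hBbarK : Bbar ≤ (congruenceGL 3 γ').comap (unitaryGroupOfForm σ J).subtype) :
    (fun p : ↥(unitaryGroupOfForm σ J) × ↥(unitaryGroupOfForm σ J) => p.1 * p.2 * p.1⁻¹) ''
        ((((congruenceGL 3 γ).comap (unitaryGroupOfForm σ J).subtype : Subgroup ↥(unitaryGroupOfForm σ J)) : Set ↥(unitaryGroupOfForm σ J))) ×ˢ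
          ((s : ↥(unitaryGroupOfForm σ J)) • (((((congruenceGL 3 γ).comap (unitaryGroupOfForm σ J).subtype) ⊓ torusU σ J :
            Subgroup ↥(unitaryGroupOfForm σ J)) : Set ↥(unitaryGroupOfForm σ J)))) =
      (s : ↥(unitaryGroupOfForm σ J)) •
        ((Bbar ⊔ ((((congruenceGL 3 γ).comap (unitaryGroupOfForm σ J).subtype) ⊓ torusU σ J) ⊔
          (B ⊔ (congruenceGL 3 ε).comap (unitaryGroupOfForm σ J).subtype)) : Subgroup ↥(unitaryGroupOfForm σ J)) : Set ↥(unitaryGroupOfForm σ J)) := by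
  rw [image_conj_prod_eq_setOf]
  exact setOf_conj_eq_smul_sandwich σ hσ hJ hσc hv s hreg hd hγ0 hγ1 hγγ' hε h2γ hρ hρw δ μ ρx ρy ρx' ρy' hδ0 hδsucc hδ1 h2δ hδγ hμγ
    hρxμ hρyμ hρx'μ hρy'μ hρxδ hρyδ hρx'δ hρy'δ hρn hρwn hδμ h2μ hbasis hL1rev B Bbar hBK hB hBbar hBsub hBbarsub hEK hab hBbarK

/-! ## §3 Topology and measurability of `P̃` and `s • ↑P̃` -/

omit [TopologicalSpace K] [IsNonarchimedeanLocalField K] [Invertible (2 : K)] in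
/-- `K_ε ≤ P̃ ≤ K_γ′` (★ (J4a) `le_sandwich_and_sandwich_le` with `hC` derived from `γ ≤ γ′`). [cite: HarishChandra1970, Lemma 22] -/
theorem sandwich_le_and_le {γ γ' ε : ValueGroupWithZero K} (hγγ' : γ ≤ γ') (B Bbar : Subgroup ↥(unitaryGroupOfForm σ J))
    (hBK : B ≤ (congruenceGL 3 γ').comap (unitaryGroupOfForm σ J).subtype)
    (hEK : (congruenceGL 3 ε).comap (unitaryGroupOfForm σ J).subtype ≤ (congruenceGL 3 γ').comap (unitaryGroupOfForm σ J).subtype)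
    (hBbarK : Bbar ≤ (congruenceGL 3 γ').comap (unitaryGroupOfForm σ J).subtype) :
    (congruenceGL 3 ε).comap (unitaryGroupOfForm σ J).subtype ≤
        Bbar ⊔ ((((congruenceGL 3 γ).comap (unitaryGroupOfForm σ J).subtype) ⊓ torusU σ J) ⊔
          (B ⊔ (congruenceGL 3 ε).comap (unitaryGroupOfForm σ J).subtype)) ∧
      Bbar ⊔ ((((congruenceGL 3 γ).comap (unitaryGroupOfForm σ J).subtype) ⊓ torusU σ J) ⊔
          (B ⊔ (congruenceGL 3 ε).comap (unitaryGroupOfForm σ J).subtype)) ≤ (congruenceGL 3 γ').comap (unitaryGroupOfForm σ J).subtype :=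
  le_sandwich_and_sandwich_le hEK hBbarK (inf_le_left.trans (Subgroup.comap_mono (congruenceGL_mono hγγ'))) hBK

omit [Invertible (2 : K)] in
/-- **`P̃` is open** (`ε ≠ 0`): it contains the open subgroup `K_ε` (★ `isCompact_isOpen_comap_congruenceGL`). [cite: BourbakiGT1, Ch. III §2 n° 1] -/
theorem isOpen_sandwich (hσc : Continuous σ) {γ ε : ValueGroupWithZero K} (hε0 : ε ≠ 0) (B Bbar : Subgroup ↥(unitaryGroupOfForm σ J)) :
    IsOpen (((Bbar ⊔ ((((congruenceGL 3 γ).comap (unitaryGroupOfForm σ J).subtype) ⊓ torusU σ J) ⊔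
      (B ⊔ (congruenceGL 3 ε).comap (unitaryGroupOfForm σ J).subtype)) : Subgroup ↥(unitaryGroupOfForm σ J)) : Set ↥(unitaryGroupOfForm σ J))) := by
  have hEopen := (isCompact_isOpen_comap_congruenceGL σ (J := J) hσc hε0).2
  refine Subgroup.isOpen_mono ?_ hEopen
  exact le_sup_right.trans (le_sup_right.trans le_sup_right)

omit [Invertible (2 : K)] in
/-- **(c) `s • ↑P̃` is open** (`ε ≠ 0`). [cite: BourbakiGT1, Ch. III §2 n° 1] -/
theorem isOpen_smul_sandwich (hσc : Continuous σ) {γ ε : ValueGroupWithZero K} (hε0 : ε ≠ 0) (B Bbar : Subgroup ↥(unitaryGroupOfForm σ J))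
    (g : ↥(unitaryGroupOfForm σ J)) :
    IsOpen (g • (((Bbar ⊔ ((((congruenceGL 3 γ).comap (unitaryGroupOfForm σ J).subtype) ⊓ torusU σ J) ⊔
      (B ⊔ (congruenceGL 3 ε).comap (unitaryGroupOfForm σ J).subtype)) : Subgroup ↥(unitaryGroupOfForm σ J)) : Set ↥(unitaryGroupOfForm σ J)))) :=
  (isOpen_sandwich σ hσc hε0 B Bbar).smul g

omit [Invertible (2 : K)] in
/-- **(c) `s • ↑P̃` is closed** (`ε ≠ 0`): an open subgroup is closed, and so are its translates. [cite: BourbakiGT1, Ch. III §2 n° 1] -/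
theorem isClosed_smul_sandwich (hσc : Continuous σ) {γ ε : ValueGroupWithZero K} (hε0 : ε ≠ 0) (B Bbar : Subgroup ↥(unitaryGroupOfForm σ J))
    (g : ↥(unitaryGroupOfForm σ J)) :
    IsClosed (g • (((Bbar ⊔ ((((congruenceGL 3 γ).comap (unitaryGroupOfForm σ J).subtype) ⊓ torusU σ J) ⊔
      (B ⊔ (congruenceGL 3 ε).comap (unitaryGroupOfForm σ J).subtype)) : Subgroup ↥(unitaryGroupOfForm σ J)) : Set ↥(unitaryGroupOfForm σ J)))) := by
  have hcl := Subgroup.isClosed_of_isOpen _ (isOpen_sandwich σ hσc hε0 B Bbar (γ := γ))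
  exact hcl.smul g

omit [Invertible (2 : K)] in
/-- **(c) `s • ↑P̃` is compact** (`γ′ ≠ 0`, `ε ≠ 0`, `K_ε ≤ P̃ ≤ K_γ′`): closed inside the compact `g • K_γ′`. [cite: BourbakiGT1, Ch. I §9 n° 3] -/
theorem isCompact_smul_sandwich (hσc : Continuous σ) {γ γ' ε : ValueGroupWithZero K} (hγ'0 : γ' ≠ 0) (hε0 : ε ≠ 0) (hγγ' : γ ≤ γ')
    (B Bbar : Subgroup ↥(unitaryGroupOfForm σ J)) (hBK : B ≤ (congruenceGL 3 γ').comap (unitaryGroupOfForm σ J).subtype)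
    (hEK : (congruenceGL 3 ε).comap (unitaryGroupOfForm σ J).subtype ≤ (congruenceGL 3 γ').comap (unitaryGroupOfForm σ J).subtype)
    (hBbarK : Bbar ≤ (congruenceGL 3 γ').comap (unitaryGroupOfForm σ J).subtype) (g : ↥(unitaryGroupOfForm σ J)) :
    IsCompact (g • (((Bbar ⊔ ((((congruenceGL 3 γ).comap (unitaryGroupOfForm σ J).subtype) ⊓ torusU σ J) ⊔
      (B ⊔ (congruenceGL 3 ε).comap (unitaryGroupOfForm σ J).subtype)) : Subgroup ↥(unitaryGroupOfForm σ J)) : Set ↥(unitaryGroupOfForm σ J)))) := by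
  have hKc := (isCompact_isOpen_comap_congruenceGL σ (J := J) hσc hγ'0).1
  have hle := (sandwich_le_and_le σ hγγ' B Bbar hBK hEK hBbarK).2
  have hsub : g • (((Bbar ⊔ ((((congruenceGL 3 γ).comap (unitaryGroupOfForm σ J).subtype) ⊓ torusU σ J) ⊔
      (B ⊔ (congruenceGL 3 ε).comap (unitaryGroupOfForm σ J).subtype)) : Subgroup ↥(unitaryGroupOfForm σ J)) : Set ↥(unitaryGroupOfForm σ J))) ⊆
        g • ((((congruenceGL 3 γ').comap (unitaryGroupOfForm σ J).subtype : Subgroup ↥(unitaryGroupOfForm σ J)) : Set ↥(unitaryGroupOfForm σ J))) :=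
    Set.smul_set_mono (fun x hx => hle hx)
  exact (hKc.smul g).of_isClosed_subset (isClosed_smul_sandwich σ hσc hε0 B Bbar g) hsub

omit [Invertible (2 : K)] in
/-- **(c) `s • ↑P̃` is Borel-measurable** (`ε ≠ 0`; any Borel structure on `U`). [cite: BourbakiGT1, Ch. III §2 n° 1] -/
theorem measurableSet_smul_sandwich [MeasurableSpace ↥(unitaryGroupOfForm σ J)] [BorelSpace ↥(unitaryGroupOfForm σ J)]
    (hσc : Continuous σ) {γ ε : ValueGroupWithZero K} (hε0 : ε ≠ 0) (B Bbar : Subgroup ↥(unitaryGroupOfForm σ J)) (g : ↥(unitaryGroupOfForm σ J)) :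
    MeasurableSet (g • (((Bbar ⊔ ((((congruenceGL 3 γ).comap (unitaryGroupOfForm σ J).subtype) ⊓ torusU σ J) ⊔
      (B ⊔ (congruenceGL 3 ε).comap (unitaryGroupOfForm σ J).subtype)) : Subgroup ↥(unitaryGroupOfForm σ J)) : Set ↥(unitaryGroupOfForm σ J)))) :=
  (isOpen_smul_sandwich σ hσc hε0 B Bbar g).measurableSet

end Summit.HodgeConjecture.HodgeConjecture.Cruxes.H413.F0P3cStCharTSTubeOrbitEq
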